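import Literature.AlgebraicGeometry.Hu2025.Statements.S04ModelV.R104aBinomialClasses
import Literature.AlgebraicGeometry.Hu2025.Statements.S04ModelV.R105aGoverning
import Literature.AlgebraicGeometry.Hu2025.Statements.S04ModelV.R105bCharts
import HarnessLib


/-!
# Hu 2025 (arXiv:2507.21400v1), §4.4 «The non-toroidal part of the defining ideal of 𝒱 in ℛ: ker^{mh} φ_Gr» (chunks p0028
# l.159 – p0031 l.117; PDF pp.65–73): `φ_{[k],Gr}` (4.29), Lem. 4.36, Def. 4.37 `L_F` / `L_𝓕` (4.30), the expression
# (4.31)/(4.32), Def. 4.42 ϖϱ-Plücker relations `𝓕^{ϖϱ}_{[k]}`, Cor. 4.43, Prop. 4.44, Def. 4.45 standard charts of `ℛ_{[k]}`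
# ((4.34) `Λ^o_{[k]}`, `Λ^⋆_{[k]}`, «lies over»), Lem. 4.46 and Cor. 4.47 (the equations of `𝒱_{[k]} ⊂ ℛ_{[k]}` and of `𝒱 ⊂ ℛ`):
# PARTITION-HU row 104, file b (`S04ModelV/R104bEquationsOfV.lean`; decls `Def4_37` (alias of I-GOV `linPl`), `Def4_42`,
# `Cor4_43`, `Prop4_44`, `Def4_45` (alias of row 105's `StdChart0`), `Lem4_46`, `Cor4_47` and their definientia/readings).
# STATEMENTS-FIRST typing (rung M-Hu of LADDER-RESOLUTION, D-0089); typer res-type-044 (body of record v2 b4ead3a358bfb389,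
# PARTITION-HU v1.15 §3c.1: chart section universe-polymorphic like row 105's `R105bCharts`; `Lem4_46` CITES row 105's `Prop4_55`;
# `Cor4_47`/`Cor4_47_R2` = `Lem4_46`/`Lem4_46_R2` at `Φ = univ`), on top of row 103's `R103aModelR`/`R103bDescendants`, this row's
# file a `R104aBinomialClasses`, and row 105's `R105aGoverning` (I-GOV: `linPl`) / `R105bCharts` (`StdChart0`, `dehomog0`, `Prop4_55`).

**Status of the source (D-0012): UNREFEREED PREPRINT UNDER ADJUDICATION.** Nothing from the preprint is asserted:
definitions are REAL Lean definitions, printed claims are `def … : Prop` CANDIDATES `[claim: Hu2025, status: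
under-review]`. No proofs, no `sorry`, no `instance`, no notation. NUMBERING (PARTITION-HU §0 CUSTODY ERRATUM): in §4
the PRINTED (PDF) number = chunk number + 1 after Def. 4.1; decl names follow the PDF, docstrings carry both; PDF
EQUATION NUMBERS were read on the PDF text layer (pdfTeX) of `lit/res-lit-6/hu25/hu2025_2507.21400v1.pdf` pp.65–73:
(4.29) = `φ_{[k],Gr}` p.66, (4.30) = `L_𝓕` p.67, (4.31)/(4.32) = the expression `f = Σ sgn(s) f_s` / `φ_{[k]}(f_s) = h
x_{u_s} x_{v_s}` p.67, (4.33) = the trinomial of Ex. 4.41 p.69, (4.34) = `Λ^o_{[k]}` p.70, (4.35) p.72, (4.36)/(4.37)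
p.73 (proof of Lem. 4.46 (3)); and (4.40) = «`𝓑_{[k]} = 𝓑^℘_{[k]} ⊔ 𝓑^𝔯𝔟_{[k]}`» p.74 (§4.5.1, row 105).
HONEST CEILING (PARTITION-HU header): Part I as printed claims resolution of singularity TYPES; the summit-type claim
rests on the UNPOSTED Part II. AI typing/adjudication is weaker than expert review.

## Scope (PARTITION-HU v1.6 row 104; optional items = index only): typed here — (4.29) `φ_{[k],Gr}` and `ker^{mh}
φ_{[k],Gr}`, Lem. 4.36 [listed optional; 1 decl, the `𝒱`-analogue of I-R's `Lem4_4`], Def. 4.37 + (4.30), the generic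
primary relation `F̄ = Σ_{s ∈ S_F} sgn(s) x̄_s` the text writes in Def. 4.37 / p.67, the expression (4.31)/(4.32) as a
DATUM, Def. 4.42 (two readings of «co-prime, modulo `ker^{mh} φ_{[k]}`»), Cor. 4.43, Prop. 4.44, Def. 4.45 (alias of
res-type-079's `StdChart0` + «lies over»), Lem. 4.46 (chart-wise, + the literal-ideal reading), Cor. 4.47. Index only:
Lem. 4.38, 4.39, 4.40, Ex. 4.41, the «In more concrete terms» display of the four `L_{(123),·}` families (p.66; it is the
`n`-instantiation of `linPl`), Claims 1–3 inside the proof of Lem. 4.46 (pp.71–72).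

## Carriers: I-R's (`rel`, `mono`, `ModelRing σ T k` = `R`, `R0 σ k` = `R_0`, `toModel`, `rhoVar`, `img`, `varphi`,
`kerMH`, `RSub`, `modelVIdeal`, `wpBinomials`, `IsMultiHomogeneous`), I-GOV's `sgn : T → ℤ`, `head`, `linPl rel sgn F` (= `L_F`,
Def. 4.37 — typed there «minimal; row 104's to supersede»: SUPERSEDED HERE BY ALIAS ONLY, no second definition), row-105-b's
`StdChart0 rel Φ` (the Def. 4.45 chart datum) with `LambdaO`, `LambdaStar`, `ChartRing0`, `dehomog0`; row-104-a's
`rbBinomials` (= `𝓑^𝔯𝔟_Φ`), `degRho`.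
## Rendering choices (for the lanes; none takes a side)
* `Ī_℘` «the ideal of `R_0` generated by the relations in `𝓕`» (p.66 l.1–2 of §4.4) with `𝓕 := {F̄ : F ∈ 𝔗}`, `F̄ = primaryBar
  F = Σ_{rel t = F} sgn(t)·x̄_t` — the SAME term data (`rel`, `mono`, `sgn`) that define `L_F`; I-R's `modelVIdeal` takes this
  set as its `𝓕` argument.
* «is defined by the following relations» for the closed subscheme `𝒱_{[k]}` of the multi-projective `ℛ_{[k]}` (Lem. 4.46,
  Cor. 4.47) is typed CHART-WISE over the standard charts of Def. 4.45 — exactly the shape of res-type-079's `Prop4_55` /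
  `Prop4_56` (equality of the de-homogenised ideals in `𝕜[Var_𝔙]` for every chart `𝔙`), which is how the printed proof
  argues (p.71 «Fix any standard chart … We want to reduce `f|_𝔙` …», p.72 «on the chart 𝔙, `x_{(u_{s_{F_i,o}},
  v_{s_{F_i,o}})}` is invertible»); the LITERAL-IDEAL reading in `R` (the convention I-R used for Lem. 4.4) is the sibling
  `Lem4_46_R2` / `Cor4_47_R2`. Cor. 4.43 («the ideal `ker^{mh} φ_{[k],Gr}` is generated by …») is an identity of ideals of `R`
  generated by subsets of `R_{[k]}` (faithful: `R` is free over `R_{[k]}`).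
* Def. 4.42's «all the terms of `f` as in the expression of (4.31) are co-prime, modulo `ker^{mh} φ_{[k]}`»: reading R1
  (`Def4_42`) = the chosen `f_s` have no non-constant common divisor in `R`; reading R2 (`Def4_42_R2`) = SOME
  representatives `f_s' ≡ f_s mod ⟨ker^{mh} φ_Φ⟩` have none. The qualifier is quoted in both docstrings.
-/

noncomputable section

namespace Literature.AlgebraicGeometry.Hu2025.Statements.S04ModelV

open MvPolynomial

section EquationsOfV

universe u v w x

variable {k : Type u} [CommRing k] {σ : Type v} {T : Type w} {𝔗 : Type x}
variable (rel : T → 𝔗) (mono : T → (σ →₀ ℕ)) (sgn : T → ℤ)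

/-! ## The primary relation written on its terms (Def. 4.37's «`F̄ = Σ_{s ∈ S_F} sgn(s) x_{u_s} x_{v_s}`», p.66/p.67) -/

/-- **Hu 2025, chunk p0029 l.32–33, l.63; PDF p.66 (Def. 4.37) / p.67**, verbatim: «Given any `F̄ ∈ 𝓕`, written as `F̄ =
Σ_{s ∈ S_F} sgn(s) x_{u_s} x_{v_s}`» — the de-homogenised primary Plücker relation of the block `F` REBUILT from the term
data (`x̄_s = img mono s`, `x̄_m = 1`): `Σ_{rel t = F} sgn(t)·x̄_t ∈ R_0`. At the instantiation of rows 101/102 this is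
I-PL's `primaryRelBar`; typed here so that `Ī_℘`, (4.32) and Lem. 4.46's «`F̄_j, k < j`» use the same terms as `L_F`.
[claim: Hu2025, status: under-review]
STATUS: candidate statement under adjudication (D-0012/D-0089); not asserted. -/
def primaryBar [Fintype T] [DecidableEq 𝔗] (F : 𝔗) : R0 σ k :=
  ∑ t ∈ Finset.univ.filter (fun t => rel t = F), (sgn t : R0 σ k) * img mono t

/-- The set `𝓕 = {F̄ : F̄ a primary relation}` as a subset of `R_0` (chunk p0029 l.1–2; PDF p.66: «`Ī_℘` is the ideal of
`R_0` generated by the relations in `𝓕`») — the argument `𝓕` of I-R's `modelVIdeal`. Plumbing.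
[claim: Hu2025, status: under-review]
STATUS: candidate statement under adjudication (D-0012/D-0089); not asserted. -/
def primaryBarSet [Fintype T] [DecidableEq 𝔗] : Set (R0 σ k) :=
  Set.range (primaryBar (k := k) rel mono sgn)

/-! ## (4.29) `φ_{[k],Gr}` and `ker^{mh} φ_{[k],Gr}` (chunk p0028 l.163 – p0029 l.2, l.14–15; PDF p.66) -/

/-- **Hu 2025, (4.29), `φ_{[k],Gr} : R_{[k]} → R_0/Ī_℘`** (chunk p0028 l.165–173, p0029 l.1–2; PDF p.66), verbatim:
«Corresponding to the embedding `𝒱_{[k]} ⊂ ℛ_{[k]}` of (4.4), we have the homomorphism (4.29) `φ_{[k],Gr} : R_{[k]} ⟶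
R_0/Ī_℘`, `φ_{[k],Gr}|_{R_0} = Id_{R_0}`, `x_{(u_s,v_s)} → x_{u_s} x_{v_s} + Ī_℘` for all `s ∈ S_{F_i}, i ∈ [k]`, where
`Ī_℘` is the de-homogenization of the Plücker ideal `I_℘` with respect to the chart `(p_{123} ≡ 1)`, i,e., `Ī_℘` is the
ideal of `R_0` generated by the relations in `𝓕`.» -- sic («`|_{R_0} = Id_{R_0}`»: the restriction is the quotient
map). On the one ambient ring `R`: `φ` followed by `R_0 → R_0/⟨𝓕⟩`; `φ_{[k],Gr}` is its restriction to `R_{[k]}`.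
[claim: Hu2025, status: under-review]
STATUS: candidate statement under adjudication (D-0012/D-0089); not asserted. -/
def varphiGr (𝓕 : Set (R0 σ k)) : ModelRing σ T k →ₐ[k] (R0 σ k ⧸ Ideal.span 𝓕) :=
  (Ideal.Quotient.mkₐ k (Ideal.span 𝓕)).comp (varphi (k := k) mono)

/-- **Hu 2025, (4.29)** — numbered alias of `varphiGr`. [claim: Hu2025, status: under-review]
STATUS: candidate statement under adjudication (D-0012/D-0089); not asserted. -/
abbrev Eq4_29 (𝓕 : Set (R0 σ k)) : ModelRing σ T k →ₐ[k] (R0 σ k ⧸ Ideal.span 𝓕) :=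
  varphiGr (k := k) (T := T) mono 𝓕

/-- **Hu 2025, `ker^{mh} φ_{[k],Gr}`** (chunk p0029 l.7, l.14–19; PDF p.66: «is defined by `ker^{mh} φ_{[k],Gr}`», «We need
to investigate `ker^{mh} φ_{[k],Gr}`. We let `f ∈ R_{[k]}` be any multi-homogenous polynomial. Then, by (4.29),
`φ_{[k],Gr}(f) = 0` if and only if `φ_{[k]}(f) ∈ Ī_℘`») — the multi-homogeneous members of `R_Φ` killed by `φ_{Φ,Gr}`
(as a subset of `R`; cf. I-R's `kerMH`). [claim: Hu2025, status: under-review]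
STATUS: candidate statement under adjudication (D-0012/D-0089); not asserted. -/
def kerMHGr [DecidableEq 𝔗] (𝓕 : Set (R0 σ k)) (Φ : Set 𝔗) : Set (ModelRing σ T k) :=
  {f | f ∈ RSub (k := k) rel Φ ∧ IsMultiHomogeneous (k := k) (σ := σ) rel f ∧ varphiGr (k := k) mono 𝓕 f = 0}

/-- **Hu 2025, Lem. 4.36 ‹chunk Lemma 4.35›** (chunk p0029 l.4–10; PDF p.66), verbatim: «The scheme `𝒱_{[k]}`, as a closed
subscheme of `ℛ_{[k]} = 𝕌 × Π_{i ∈ [k]} ℙ_{F_i}`, is defined by `ker^{mh} φ_{[k],Gr}`. Proof. This is immediate.» — in the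
convention I-R chose for the parallel Lem. 4.4: the ideal of `𝒱_Φ` (`modelVIdeal`, closure of the graph of `Θ_{[k],Gr}`)
equals the ideal of `R` generated by `ker^{mh} φ_{Φ,Gr}`; `𝓕 := primaryBarSet`. (PARTITION-HU lists Lem. 4.36 as optional;
typed because Cor. 4.43 / Lem. 4.46 start from it.) [claim: Hu2025, status: under-review]
STATUS: candidate statement under adjudication (D-0012/D-0089); not asserted. -/
def Lem4_36 [Fintype T] [DecidableEq 𝔗] (Φ : Set 𝔗) : Prop :=
  modelVIdeal (k := k) rel mono (primaryBarSet (k := k) rel mono sgn) Φ =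
    Ideal.span (kerMHGr (k := k) rel mono (primaryBarSet (k := k) rel mono sgn) Φ)

/-! ## Def. 4.37 ‹chunk Definition 4.36› and (4.30) (chunk p0029 l.32–58; PDF pp.66–67) -/

/-- **Hu 2025, Def. 4.37 ‹chunk Definition 4.36›, the linearized Plücker relation `L_F`** (chunk p0029 l.32–38; PDF
p.66), verbatim: «Given any `F̄ ∈ 𝓕`, written as `F̄ = Σ_{s ∈ S_F} sgn(s) x_{u_s} x_{v_s}`, we introduce `L_F : Σ_{s ∈ S_F}
sgn(s) x_{(u_s,v_s)}`. This is called the linearized Plücker relation with respect to `F̄` (or `F`). It is a canonical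
linear relation on `ℙ_F`.» — numbered ALIAS of I-GOV's `linPl` (row 105 file a typed the sum; no second definition).
The «In more concrete terms» display p.66 (chunk p0029 l.47–54: `L_{(123),1uv} = x_{(123,1uv)} − x_{(12u,13v)} +
x_{(13u,12v)}`, …, `L_{(123),abc} = x_{(123,abc)} − x_{(12a,3bc)} + x_{(13a,2bc)} − x_{(23a,1bc)}`) is its instantiation
at rows 101/102's term tables (index only). [claim: Hu2025, status: under-review]
STATUS: candidate statement under adjudication (D-0012/D-0089); not asserted. -/
abbrev Def4_37 [Fintype T] [DecidableEq 𝔗] (F : 𝔗) : ModelRing σ T k := linPl (k := k) (σ := σ) rel sgn F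

/-- **Hu 2025, (4.30), `L_𝓕 = {L_F ∣ F̄ ∈ 𝓕}`** (chunk p0029 l.40–45, repeated p0031 l.102–107; PDF p.67, p.73), verbatim:
«We let (4.30) `L_𝓕 = {L_F ∣ F̄ ∈ 𝓕}` be the set of all linearized Plücker relations.» In-text remark l.56–58: «among all
linearized Plücker relations, only `L_{F_i}` with `i ∈ [k]` belong to `R̄_{[k]}`» -- sic (`R̄_{[k]}` for `R_{[k]}`).
[claim: Hu2025, status: under-review]
STATUS: candidate statement under adjudication (D-0012/D-0089); not asserted. -/
def linPlSet [Fintype T] [DecidableEq 𝔗] : Set (ModelRing σ T k) :=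
  Set.range (linPl (k := k) (σ := σ) rel sgn)

/-- **Hu 2025, (4.30)** — numbered alias of `linPlSet`. [claim: Hu2025, status: under-review]
STATUS: candidate statement under adjudication (D-0012/D-0089); not asserted. -/
abbrev Eq4_30 [Fintype T] [DecidableEq 𝔗] : Set (ModelRing σ T k) := linPlSet (k := k) (σ := σ) rel sgn

/-- **Hu 2025, in-text claim chunk p0029 l.57–58; PDF p.67**, verbatim: «Clearly, `L_{F_i} ∈ ker^{mh} φ_{[k],Gr}`.» (for `i ∈
[k]`) — for `F ∈ Φ`, with `𝓕 := primaryBarSet`. Typed claim. [claim: Hu2025, status: under-review]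
STATUS: candidate statement under adjudication (D-0012/D-0089); not asserted. -/
def C29L57 [Fintype T] [DecidableEq 𝔗] (Φ : Set 𝔗) : Prop :=
  ∀ F ∈ Φ, linPl (k := k) (σ := σ) rel sgn F ∈ kerMHGr (k := k) rel mono (primaryBarSet (k := k) rel mono sgn) Φ

/-! ## (4.31)/(4.32): the expression `f = Σ sgn(s) f_s` (chunk p0029 l.60–72; PDF p.67) -/

/-- **Hu 2025, (4.31)/(4.32)** (chunk p0029 l.60–72; PDF p.67), verbatim: «Fix any `F̄ ∈ 𝓕`. Let `f ∈ R_{[k]}` be any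
multi-homogenous polynomial such that `φ_{[k]}(f) = h F̄` for some `h ∈ R_0`. We then write `F̄ = Σ_{s ∈ S_F} sgn(s) x_{u_s}
x_{v_s}`. Accordingly, we express (4.31) `f = Σ_{s ∈ S_F} sgn(s) f_s` such that (4.32) `φ_{[k]}(f_s) = h x_{u_s} x_{v_s}`,
for all `s ∈ S_F`.» — the DATUM (`F`, `f`, `h`, the family `f_s`, `s ∈ S_F`) with the two displayed identities; how the
`f_s` are chosen is not discussed in print (the structure records what the text writes, nothing more); the `f_s` are
not required to lie in `R_{[k]}` (the text: «for some `T_t ∈ R`», p.68). [claim: Hu2025, status: under-review]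
STATUS: candidate statement under adjudication (D-0012/D-0089); not asserted. -/
structure Eq4_31Datum [Fintype T] [DecidableEq 𝔗] (rel : T → 𝔗) (mono : T → (σ →₀ ℕ)) (sgn : T → ℤ)
    (Φ : Set 𝔗) where
  /-- the fixed block `F̄ ∈ 𝓕` -/
  F : 𝔗
  /-- the multi-homogeneous `f ∈ R_{[k]}` -/
  f : ModelRing σ T k
  /-- `h ∈ R_0` with `φ(f) = h F̄` -/
  h : R0 σ k
  /-- the terms `f_s`, `s ∈ S_F` (only `rel s = F` is used) -/
  fs : T → ModelRing σ T k
  /-- `f ∈ R_{[k]}` -/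
  f_mem : f ∈ RSub (k := k) rel Φ
  /-- `f` is multi-homogeneous -/
  f_mh : IsMultiHomogeneous (k := k) (σ := σ) rel f
  /-- (4.31) `f = Σ_{s ∈ S_F} sgn(s) f_s` -/
  sum_eq : f = ∑ t ∈ Finset.univ.filter (fun t => rel t = F), (sgn t : ModelRing σ T k) * fs t
  /-- (4.32) `φ(f_s) = h · x̄_s` for all `s ∈ S_F` -/
  phi_eq : ∀ t : T, rel t = F → varphi (k := k) mono (fs t) = h * img mono t

/-! ## Def. 4.42 ‹chunk Definition 4.41› (chunk p0030 l.28–36; PDF p.69) — ϖϱ-Plücker relations -/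

/-- «co-prime» for a family of polynomials (Def. 4.42; the text's usage p.59 «`h` and `g` are co-prime»): every common
divisor is a constant. Plumbing. [claim: Hu2025, status: under-review]
STATUS: candidate statement under adjudication (D-0012/D-0089); not asserted. -/
def AreCoprime {ι : Type w} (g : ι → ModelRing σ T k) : Prop :=
  ∀ d : ModelRing σ T k, (∀ i, d ∣ g i) → ∃ c : k, d = C c

/-- **Hu 2025, Def. 4.42 ‹chunk Definition 4.41›, ϖϱ-Plücker relation — READING R1** (chunk p0030 l.28–33; PDF p.69),
verbatim: «Let `f ∈ R_{[k]}`. Assume `f ∉ L_𝓕` with `deg_ϱ f > 0` be as in (4.31) such that `φ(f) = h F` for some `F̄ ∈ 𝓕`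
and all the terms of `f` as in the expression of (4.31) are co-prime, modulo `ker^{mh} φ_{[k]}`, then we say `f` is a
ϖϱ-Plücker relation.» — on a (4.31)-datum `D`: `D.f ∉ L_𝓕`; `deg_ϱ D.f > 0` (every monomial of the multi-homogeneous
`D.f ≠ 0` has positive ϱ-degree); the terms `(D.f_s)_{s ∈ S_F}` are co-prime IN `R`. The qualifier «, modulo `ker^{mh}
φ_{[k]}`» is NOT given a separate meaning in this reading (see `Def4_42_R2`). [claim: Hu2025, status: under-review]
STATUS: candidate statement under adjudication (D-0012/D-0089); not asserted. -/
def Def4_42 [Fintype T] [DecidableEq 𝔗] {Φ : Set 𝔗} (D : Eq4_31Datum (k := k) rel mono sgn Φ) : Prop :=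
  D.f ∉ linPlSet (k := k) (σ := σ) rel sgn ∧ D.f ≠ 0 ∧ (∀ a ∈ D.f.support, 0 < degRho (σ := σ) (T := T) a) ∧
    AreCoprime (k := k) (fun t : {t : T // rel t = D.F} => D.fs t.1)

/-- **Hu 2025, Def. 4.42 — READING R2 of «co-prime, modulo `ker^{mh} φ_{[k]}`»** (chunk p0030 l.31–32; PDF p.69): as
`Def4_42`, but the co-primality is asked of SOME representatives `f_s' ≡ f_s (mod ⟨ker^{mh} φ_Φ⟩)`. Sibling reading; the
lanes / the row-104 owner decide which to keep. [claim: Hu2025, status: under-review]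
STATUS: candidate statement under adjudication (D-0012/D-0089); not asserted. -/
def Def4_42_R2 [Fintype T] [DecidableEq 𝔗] {Φ : Set 𝔗} (D : Eq4_31Datum (k := k) rel mono sgn Φ) : Prop :=
  D.f ∉ linPlSet (k := k) (σ := σ) rel sgn ∧ D.f ≠ 0 ∧ (∀ a ∈ D.f.support, 0 < degRho (σ := σ) (T := T) a) ∧
    ∃ fs' : T → ModelRing σ T k,
      (∀ t : T, rel t = D.F → fs' t - D.fs t ∈ Ideal.span (kerMH (k := k) rel mono Φ)) ∧
        AreCoprime (k := k) (fun t : {t : T // rel t = D.F} => fs' t.1)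

/-- **Hu 2025, Def. 4.42, the set `𝓕^{ϖϱ}_{[k]}`** (chunk p0030 l.35–36; PDF p.69), verbatim: «We denote the set of all
ϖϱ-Plücker relations in `R_{[k]}` by `𝓕^{ϖϱ}_{[k]}`.» — the `f` of the (4.31)-data satisfying `Def4_42` (reading R1).
[claim: Hu2025, status: under-review]
STATUS: candidate statement under adjudication (D-0012/D-0089); not asserted. -/
def varpiRhoRels [Fintype T] [DecidableEq 𝔗] (Φ : Set 𝔗) : Set (ModelRing σ T k) :=
  {f | ∃ D : Eq4_31Datum (k := k) rel mono sgn Φ, D.f = f ∧ Def4_42 (k := k) rel mono sgn D}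

/-! ## Cor. 4.43 ‹chunk Corollary 4.42› and Prop. 4.44 ‹chunk Proposition 4.43› (chunk p0030 l.38–65; PDF p.70) -/

/-- **Hu 2025, Cor. 4.43 ‹chunk Corollary 4.42›** (chunk p0030 l.38–48; PDF p.70), verbatim: «The ideal `ker^{mh}
φ_{[k],Gr}` is generated by `ker^{mh} φ_{[k]}`, and all the relations in `𝓕`, `{L_{F_i} ∣ i ∈ [k]}`, and `𝓕^{ϖϱ}_{[k]}`.
Proof. This follows directly from the above discussions.» — as an identity of ideals of `R` generated by subsets of
`R_{[k]}`: `⟨ker^{mh} φ_{Φ,Gr}⟩ = ⟨ker^{mh} φ_Φ ∪ 𝓕 ∪ L_Φ ∪ 𝓕^{ϖϱ}_Φ⟩`, `𝓕 := primaryBarSet` (moved into `R` by `toModel`),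
`𝓕^{ϖϱ}_Φ` in reading R1. (Joint index: G-H5 reads this sentence; it is not one of the four M-Hu-min joints.)
[claim: Hu2025, status: under-review]
STATUS: candidate statement under adjudication (D-0012/D-0089); not asserted. -/
def Cor4_43 [Fintype T] [DecidableEq 𝔗] (Φ : Set 𝔗) : Prop :=
  Ideal.span (kerMHGr (k := k) rel mono (primaryBarSet (k := k) rel mono sgn) Φ) =
    Ideal.span (kerMH (k := k) rel mono Φ ∪
      (toModel (T := T)) '' primaryBarSet (k := k) rel mono sgn ∪
      (linPl (k := k) (σ := σ) rel sgn) '' Φ ∪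
      varpiRhoRels (k := k) rel mono sgn Φ)

/-- **Hu 2025, Prop. 4.44 ‹chunk Proposition 4.43›** (chunk p0030 l.50–65; PDF p.70), verbatim: «Let `f ∈ R_{[k]}` be any
ϖϱ-relation such that `φ(f) = hF` for some `h`. Then, following the notation above, we have `x_{(u_t,v_t)} f_s − x_{(u_s,v_s)}
f_t ∈ ker^{mh} φ_{[k]}` for all `s, t ∈ S_F`. Proof. This follows directly from (4.32).» — for every (4.31)-datum that is
a ϖϱ-Plücker relation (reading R1) and all terms `s, t` of its block. [claim: Hu2025, status: under-review]
STATUS: candidate statement under adjudication (D-0012/D-0089); not asserted. -/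
def Prop4_44 [Fintype T] [DecidableEq 𝔗] (Φ : Set 𝔗) : Prop :=
  ∀ D : Eq4_31Datum (k := k) rel mono sgn Φ, Def4_42 (k := k) rel mono sgn D →
    ∀ s t : T, rel s = D.F → rel t = D.F →
      rhoVar (k := k) (σ := σ) t * D.fs s - rhoVar (k := k) (σ := σ) s * D.fs t ∈ kerMH (k := k) rel mono Φ

end EquationsOfV

/-! ## Def. 4.45 ‹chunk Definition 4.44›, Lem. 4.46 ‹chunk Lemma 4.45›, Cor. 4.47 ‹chunk Corollary 4.46› — over the
standard charts (res-type-079's `StdChart0`; universe-polymorphic `k : Type u`, `σ : Type v`, `T : Type w`, `𝔗 : Type x`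
exactly as row 105 file b v4, sha16 867e52f6b4b6442d) -/

section ChartsOfV

universe u v w x

variable {k : Type u} [CommRing k] {σ : Type v} {T : Type w} {𝔗 : Type x}
variable (rel : T → 𝔗) (mono : T → (σ →₀ ℕ)) (sgn : T → ℤ)

/-- **Hu 2025, Def. 4.45 ‹chunk Definition 4.44›, standard charts of `ℛ_{[k]}`** (chunk p0030 l.81–91; PDF p.70),
verbatim: «Fix `k ∈ [Υ]`. For every `F̄_i ∈ 𝓕` with `i ∈ [k]`, choose and fix an arbitrary element `s_{F_i,o} ∈ S_{F_i}`.
Then, the scheme `ℛ_{[k]}` is covered by the affine open charts of the form `𝕌 × Π_{i ∈ [k]} (x_{(u_{s_{F_i,o}},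
v_{s_{F_i,o}})} ≡ 1) ⊂ ℛ_{[k]} = 𝕌 × Π_{i ∈ [k]} ℙ_{F_i}`. We call such an affine open subset a standard chart of `ℛ_{[k]}`,
often denoted by `𝔙`.» — numbered ALIAS of the chart datum `StdChart0 rel Φ` (a choice `o` of one term per block `F ∈
Φ`; typed in row 105 file b by res-type-079, which PARTITION-HU also lists there; PARTITION's row-104 name `chartRk`
= the same object). Its index set `Λ^o_{[k]}` is display **(4.34)** p.70 (`StdChart0.LambdaO`) and `Λ^⋆_{[k]} = (⋃ Λ_{F_i})
∖ Λ^o_{[k]}` (`StdChart0.LambdaStar`); the covering assertion itself is scheme-level (row 110). [claim: Hu2025, status: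
under-review]
STATUS: candidate statement under adjudication (D-0012/D-0089); not asserted. -/
abbrev Def4_45 (Φ : Set 𝔗) : Type (max w x) := StdChart0 rel Φ

variable {rel}

/-- **Hu 2025, Def. 4.45 continued, «`𝔙` lies over `𝔙'`»** (chunk p0030 l.93–103; PDF p.70), verbatim: «Given any standard
chart `𝔙` as in the definition above, we let `𝔙' = 𝕌 × Π_{i ∈ [k−1]} (x_{(u_{s_{F_i,o}}, v_{s_{F_i,o}})} ≡ 1) ⊂ ℛ_{𝓕_{[k−1]}}`
… Then, this is a standard chart of `ℛ_{𝓕_{[k−1]}}`, uniquely determined by `𝔙`. We say `𝔙` lies over `𝔙'`. In general,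
suppose `𝔙''` is a standard chart of `ℛ_{𝓕_{[j]}}` with `j < k − 1`. Via induction, we say `𝔙` lies over `𝔙''` if `𝔙` lies
over some `𝔙'` as above and `𝔙'` lies over `𝔙''`.» — unwound: `𝔙` over `Φ` lies over `𝔙''` over `Φ'' ⊆ Φ` iff the chosen
terms agree on `Φ''` (the printed chain of initial segments `𝓕_{[j]} ⊂ 𝓕_{[k]}` is `Φ'' ⊆ Φ`).
[claim: Hu2025, status: under-review]
STATUS: candidate statement under adjudication (D-0012/D-0089); not asserted. -/
def StdChart0.LiesOver {Φ Φ'' : Set 𝔗} (𝔙 : StdChart0 rel Φ) (𝔙'' : StdChart0 rel Φ'') : Prop :=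
  Φ'' ⊆ Φ ∧ ∀ F ∈ Φ'', 𝔙.o F = 𝔙''.o F

variable (rel)

/-- The relation set of Lem. 4.46 moved to the chart `𝔙` (plumbing shared by `Lem4_46` / `Cor4_47`): the
de-homogenisations of `𝓑^℘_Φ`, `𝓑^𝔯𝔟_Φ`, `{L_F : F ∈ Φ}` and of the remaining primary relations `{F̄ : F ∉ Φ}` (in `R` via
`toModel`). [claim: Hu2025, status: under-review]
STATUS: candidate statement under adjudication (D-0012/D-0089); not asserted. -/
def lem446Relations [Fintype T] [DecidableEq 𝔗] (Φ : Set 𝔗) : Set (ModelRing σ T k) :=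
  wpBinomials (k := k) rel mono Φ ∪ rbBinomials (k := k) rel mono Φ ∪ (linPl (k := k) (σ := σ) rel sgn) '' Φ ∪
    (fun F => toModel (T := T) (primaryBar (k := k) rel mono sgn F)) '' Φᶜ

/-- **Hu 2025, Lem. 4.46 ‹chunk Lemma 4.45›** (chunk p0030 l.132–138; PDF p.71), verbatim: «The scheme `𝒱_{[k]}`, as a
closed subscheme of `ℛ_{[k]} = 𝕌 × Π_{i=1}^k ℙ_{F_i}`, is defined by the following relations in `𝓑^℘_{[k]}`, `𝓑^𝔯𝔟_{[k]}`,
`{L_{F_i}, i ∈ [k]}`, `{F̄_j, k < j ≤ Υ}`.» — CHART-WISE reading (module docstring): for every standard chart `𝔙` of `ℛ_Φ`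
(Def. 4.45), the de-homogenisation of the ideal of `𝒱_Φ` (`modelVIdeal` over `𝓕 := primaryBarSet`) equals the ideal of
`𝕜[Var_𝔙]` generated by the de-homogenised relations; `[k] ↦ Φ`, «`k < j ≤ Υ`» ↦ `F ∉ Φ`. This IS row 105 file b's
`Prop4_55` (res-type-079; Prop. 4.55 ‹4.54› restates Lem. 4.46 chart by chart, with `𝓑_{[k]} = 𝓑^℘_{[k]} ⊔ 𝓑^𝔯𝔟_{[k]}`
by (4.40)) at `Fbar := primaryBar` (so `Set.range Fbar = primaryBarSet`), `Brb := rbBinomials Φ` (`𝓑^𝔯𝔟_Φ`, Def. 4.32,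
row 104 file a), for EVERY standard chart `𝔙` — cited by name, not restated. The literal-ideal reading is the sibling
`Lem4_46_R2`. [claim: Hu2025, status: under-review]
STATUS: candidate statement under adjudication (D-0012/D-0089); not asserted. -/
def Lem4_46 [Fintype T] [DecidableEq 𝔗] (Φ : Set 𝔗) : Prop :=
  ∀ 𝔙 : StdChart0 rel Φ,
    Prop4_55 (k := k) (rel := rel) mono sgn (primaryBar (k := k) rel mono sgn) (rbBinomials (k := k) rel mono Φ) Φ 𝔙

/-- **Hu 2025, Lem. 4.46 — READING R2 (literal ideal of `R`)** (same locator): in the convention I-R used for Lem. 4.4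
(«defined by» = equality of the carrying ideals of `R`): `modelVIdeal … Φ = ⟨𝓑^℘_Φ ∪ 𝓑^𝔯𝔟_Φ ∪ L_Φ ∪ {F̄ : F ∉ Φ}⟩`. Sibling
reading for the lanes (no saturation; stronger than the chart-wise statement). [claim: Hu2025, status: under-review]
STATUS: candidate statement under adjudication (D-0012/D-0089); not asserted. -/
def Lem4_46_R2 [Fintype T] [DecidableEq 𝔗] (Φ : Set 𝔗) : Prop :=
  modelVIdeal (k := k) rel mono (primaryBarSet (k := k) rel mono sgn) Φ =
    Ideal.span (lem446Relations (k := k) rel mono sgn Φ)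

/-- **Hu 2025, Cor. 4.47 ‹chunk Corollary 4.46›** (chunk p0031 l.109–116; PDF p.73), verbatim: «By the case of Lemma 4.46
when `k = Υ`, we have Corollary 4.47. The scheme `𝒱`, as a closed subscheme of `ℛ = 𝕌 × Π_{F̄ ∈ 𝓕} ℙ_F`, is defined by the
following relations in `𝓑^℘`, `𝓑^𝔯𝔟`, `L_𝓕`.» — typed AS DERIVED IN PRINT: `Lem4_46` at `Φ = univ` (`[k] = [Υ]`;
the family «`F̄_j, k < j ≤ Υ`» is indexed by `univᶜ = ∅`), chart-wise. This is the sentence PARTITION-HU §3 row 104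
flags as «what G-H2 calls «these equations»» (J3 reads it through Prop. 4.56 / Prop. 5.16; note Prop. 4.56's generating
set `𝓑^gov ⊔ 𝓑^ngv ⊔ 𝓑^𝔯𝔟` is SMALLER than `𝓑^℘ ⊔ 𝓑^𝔯𝔟` here — different decls). The carriers `rel mono sgn` are bound
on the def line (no parameter-free `def … : Prop`). [claim: Hu2025, status: under-review]
STATUS: candidate statement under adjudication (D-0012/D-0089); not asserted. -/
def Cor4_47 (rel : T → 𝔗) (mono : T → (σ →₀ ℕ)) (sgn : T → ℤ) [Fintype T] [DecidableEq 𝔗] : Prop :=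
  Lem4_46 (k := k) rel mono sgn (Set.univ : Set 𝔗)

/-- **Hu 2025, Cor. 4.47 — READING R2 (literal ideal of `R`)**: `modelVIdeal … univ = ⟨𝓑^℘ ∪ 𝓑^𝔯𝔟 ∪ L_𝓕 ∪ ∅⟩`, i.e.
`Lem4_46_R2` at `Φ = univ`. Sibling reading (cf. `Lem4_46_R2`). [claim: Hu2025, status: under-review]
STATUS: candidate statement under adjudication (D-0012/D-0089); not asserted. -/
def Cor4_47_R2 (rel : T → 𝔗) (mono : T → (σ →₀ ℕ)) (sgn : T → ℤ) [Fintype T] [DecidableEq 𝔗] : Prop :=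
  Lem4_46_R2 (k := k) rel mono sgn (Set.univ : Set 𝔗)

end ChartsOfV

end Literature.AlgebraicGeometry.Hu2025.Statements.S04ModelV

end
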